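import Summits.HubbardSuperconductivity.HubbardSuperconductivity.Theses.ParityLeeYang

/-!
# Route `ParityLeeYang` — glue item `ThesisOfWindowAndBridge`

`ThesisOfWindowAndBridge` (stmt-HubbardSuperconductivity-14279): `ParityPositiveWindow →
ParityBridge → Thesis`; the thesis is literally the conjunction of the window and the bridge
(the assembly item is `Theorems/ParityLeeYangAssembly.lean`). No new definitions.
-/

-- the mandated namespace `Summit.<Summit>.<Problem>.Theorems` repeats `HubbardSuperconductivity`
-- (single-problem summit, D-0017), which the `dupNamespace` linter flags on every declaration
set_option linter.dupNamespace false

namespace Summit.HubbardSuperconductivity.HubbardSuperconductivity.Theorems.ParityLeeYang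

open Summit.HubbardSuperconductivity.HubbardSuperconductivity.Theses.ParityLeeYang

/-- **`ThesisOfWindowAndBridge`** (stmt-HubbardSuperconductivity-14279): the thesis of the route is
the conjunction of the parity-positive window and the parity bridge. [folklore] -/
theorem thesisOfWindowAndBridge_proof :
    Summit.HubbardSuperconductivity.HubbardSuperconductivity.Theses.ParityLeeYang.ThesisOfWindowAndBridge := by
  unfold ThesisOfWindowAndBridge Thesis ParityPositiveWindow ParityBridge
  intro hW hB
  exact ⟨hW, hB⟩

end Summit.HubbardSuperconductivity.HubbardSuperconductivity.Theorems.ParityLeeYang
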